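import Mathlib.RepresentationTheory.Homological.GroupCohomology.LowDegree
import Mathlib.Data.Matrix.Mul
import Mathlib.LinearAlgebra.Matrix.ToLin
import Literature.AlgebraicGeometry.HodgeTheory.LocallyTrivialExtensionClasses

/-!
# Route LinearSystemTorelli — crux `LocalTubeSpan` (stmt-HodgeConjecture-2490): Schnell's example

Helper file (`--supports stmt-HodgeConjecture-2490`, line `Sketch`, stub `stub_schnellExample`).
TIGHTNESS of the crux's mechanism: Schnell's third map
`evalCoinv A : H¹(G, A) → ∏_{g ∈ G} A/(g - 1)A`, `[φ] ↦ (φ g mod (g - 1)A)_g`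
(`Literature.AlgebraicGeometry.HodgeTheory.LocallyTrivialExtensionClasses`) is NOT injective for a
general module: the rank-one / transvection hypotheses of the frame form of [Schnell2010] Prop. 12
are not idle, and an abelian group acting by commuting unipotent matrices that are not rank-one can
carry a non-zero class undetected by every single element.  This is the printed example of
C. Schnell, *Primitive cohomology and the tube mapping*, Math. Z. 268 (2010) (= arXiv:0711.3927),
§6 "Example": `G = ℤ²` acts on `M = ℚ³` through the two commuting unipotent matrices

  `A₁ = [[1,0,1],[0,1,0],[0,0,1]]`, `A₂ = [[1,2,2],[0,1,2],[0,0,1]]`,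

i.e. `ρ(a, b) = A₁^a A₂^b = [[1, 2b, 2b² + a], [0, 1, 2b], [0, 0, 1]]`, and the cocycle is
`φ(a, b) = (a, 0, 0)`.  Then `φ ∈ Z¹(G, M)` (the first basis vector is fixed), `[φ] ≠ 0`
(testing `g = (1,0)` and `g = (0,1)`), but `φ(g) ∈ (g - 1)M` for EVERY `g` (`v = (0, a/2b, 0)` if
`b ≠ 0`, `v = (0, 0, 1)` if `b = 0`), so `evalCoinv [φ] = 0 = evalCoinv 0`.

* `localTubeSpan_not_injective_evalCoinv_of_undetected` — the criterion: a cocycle that is not a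
  coboundary but is pointwise a `g`-coboundary witnesses non-injectivity of the third map.
* `localTubeSpan_exists_schnellRep` — the representation `ρ` of `ℤ²` (as
  `Multiplicative (ℤ × ℤ)`) on `Fin 3 → ℚ`, pinned down by its closed formula and by
  `ρ(1,0) = A₁`, `ρ(0,1) = A₂`.
* `localTubeSpan_schnellCocycle_mem_cocycles₁`,
  `localTubeSpan_schnellCocycle_notMem_coboundaries₁`,
  `localTubeSpan_schnellCocycle_mem_subOneRange` — the three verifications.
* `localTubeSpan_exists_not_injective_evalCoinv` — the stub: some `Rep ℚ G` has a non-injective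
  third map.

References: [Schnell2010] C. Schnell, Primitive cohomology and the tube mapping, Math. Z. 268
(2010), §3 (the third map, eq. (restr-M)), §6 Example.
-/

-- `Summit.HodgeConjecture.HodgeConjecture.Theorems` is the mandated namespace (single-conjunct summit:
-- Sub = Summit), which `linter.dupNamespace` flags on every declaration; the lakefile turns the
-- linter off tree-wide (weak option), restated here so stand-alone elaboration is warning-free too.
set_option linter.dupNamespace false

noncomputable section

open CategoryTheory groupCohomology
open Literature.AlgebraicGeometry.HodgeTheory

namespace Summit.HodgeConjecture.HodgeConjecture.Theorems

universe u

/-! ### The criterion -/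

/-- **Non-injectivity criterion for Schnell's third map.** If a `1`-cocycle `φ` is not a
coboundary but each single value `φ g` lies in `(g - 1)A` (i.e. `φ` restricts to a coboundary on
every cyclic subgroup), then `evalCoinv A : H¹(G, A) → ∏_g A/(g - 1)A` kills the non-zero class
`[φ]`, so it is not injective. [cite: Schnell2010, §6 Example] -/
theorem localTubeSpan_not_injective_evalCoinv_of_undetected {k G : Type u} [CommRing k] [Group G]
    (A : Rep k G) (φ : G → A.V) (hφ : φ ∈ cocycles₁ A) (hne : φ ∉ coboundaries₁ A)
    (hdet : ∀ g, φ g ∈ subOneRange A g) : ¬ Function.Injective (evalCoinv A) := by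
  intro hinj
  refine hne ?_
  have h0 : H1π A ⟨φ, hφ⟩ = 0 := by
    refine hinj ?_
    rw [map_zero]
    funext g
    rw [evalCoinv_H1π, Pi.zero_apply, Submodule.mkQ_apply, Submodule.Quotient.mk_eq_zero]
    exact hdet g
  simpa using (H1π_eq_zero_iff _).1 h0

/-! ### Schnell's representation of `ℤ²` on `ℚ³` -/

/-- **Schnell's representation.** There is a representation `ρ` of `ℤ²` (written
`Multiplicative (ℤ × ℤ)`) on `ℚ³ = Fin 3 → ℚ` with
`ρ(1, 0) = A₁ = [[1,0,1],[0,1,0],[0,0,1]]` and `ρ(0, 1) = A₂ = [[1,2,2],[0,1,2],[0,0,1]]`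
(two commuting unipotent matrices), namely
`ρ(a, b) = A₁^a A₂^b = [[1, 2b, 2b² + a], [0, 1, 2b], [0, 0, 1]]` acting on column vectors:
`ρ(a, b) v = (v₀ + 2b v₁ + (2b² + a) v₂, v₁ + 2b v₂, v₂)`.
[cite: Schnell2010, §6 Example] -/
theorem localTubeSpan_exists_schnellRep :
    ∃ ρ : Representation ℚ (Multiplicative (ℤ × ℤ)) (Fin 3 → ℚ),
      ρ (Multiplicative.ofAdd (1, 0)) = Matrix.mulVecLin !![(1 : ℚ), 0, 1; 0, 1, 0; 0, 0, 1] ∧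
      ρ (Multiplicative.ofAdd (0, 1)) = Matrix.mulVecLin !![(1 : ℚ), 2, 2; 0, 1, 2; 0, 0, 1] ∧
      ∀ g v, ρ g v =
        ![v 0 + 2 * ((Multiplicative.toAdd g).2 : ℚ) * v 1
            + (2 * ((Multiplicative.toAdd g).2 : ℚ) ^ 2 + (Multiplicative.toAdd g).1) * v 2,
          v 1 + 2 * ((Multiplicative.toAdd g).2 : ℚ) * v 2, v 2] := by
  refine ⟨{ toFun := fun g =>
              { toFun := fun v =>
                  ![v 0 + 2 * ((Multiplicative.toAdd g).2 : ℚ) * v 1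
                      + (2 * ((Multiplicative.toAdd g).2 : ℚ) ^ 2 + (Multiplicative.toAdd g).1)
                        * v 2,
                    v 1 + 2 * ((Multiplicative.toAdd g).2 : ℚ) * v 2, v 2]
                map_add' := fun v w => ?_
                map_smul' := fun c v => ?_ }
            map_one' := ?_
            map_mul' := fun g h => ?_ }, ?_, ?_, fun g v => rfl⟩
  · ext i
    fin_cases i <;> simp <;> ring
  · ext i
    fin_cases i <;> simp <;> ring
  · refine LinearMap.ext fun v => funext fun i => ?_
    fin_cases i <;> simp
  · refine LinearMap.ext fun v => funext fun i => ?_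
    fin_cases i <;> simp <;> ring
  · refine LinearMap.ext fun v => funext fun i => ?_
    fin_cases i <;> simp [Matrix.mulVec, dotProduct, Fin.sum_univ_three]
  · refine LinearMap.ext fun v => funext fun i => ?_
    fin_cases i <;> simp [Matrix.mulVec, dotProduct, Fin.sum_univ_three]

/-! ### The cocycle `φ(a, b) = (a, 0, 0)` -/

section Cocycle

variable (ρ : Representation ℚ (Multiplicative (ℤ × ℤ)) (Fin 3 → ℚ))
  (hρ : ∀ g v, ρ g v =
    ![v 0 + 2 * ((Multiplicative.toAdd g).2 : ℚ) * v 1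
        + (2 * ((Multiplicative.toAdd g).2 : ℚ) ^ 2 + (Multiplicative.toAdd g).1) * v 2,
      v 1 + 2 * ((Multiplicative.toAdd g).2 : ℚ) * v 2, v 2])
include hρ

/-- `φ(a, b) = (a, 0, 0)` is a `1`-cocycle of Schnell's representation: the first basis vector is
fixed by every `ρ(a, b)`, so `φ(gh) = φ(h) + φ(g) = ρ(g) φ(h) + φ(g)`.
[cite: Schnell2010, §6 Example] -/
theorem localTubeSpan_schnellCocycle_mem_cocycles₁ :
    (fun g => ![((Multiplicative.toAdd g).1 : ℚ), 0, 0]) ∈ cocycles₁ (Rep.of ρ) := by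
  rw [mem_cocycles₁_iff]
  intro g h
  rw [Rep.of_ρ, hρ]
  funext i
  fin_cases i <;> simp
  ring

/-- `φ(a, b) = (a, 0, 0)` is NOT a coboundary of Schnell's representation, i.e. `[φ] ≠ 0` in
`H¹(ℤ², ℚ³)`: the equation `ρ g x - x = φ g` at `g = (0, 1)` reads
`(2x₁ + 2x₂, 2x₂, 0) = 0`, forcing `x₂ = 0`, while at `g = (1, 0)` it reads
`(x₂, 0, 0) = (1, 0, 0)`, forcing `x₂ = 1`.
[cite: Schnell2010, §6 Example] -/
theorem localTubeSpan_schnellCocycle_notMem_coboundaries₁ :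
    (fun g => ![((Multiplicative.toAdd g).1 : ℚ), 0, 0]) ∉ coboundaries₁ (Rep.of ρ) := by
  rw [mem_coboundaries₁_iff_exists]
  rintro ⟨x, hx⟩
  have h1 := congr_fun (hx (Multiplicative.ofAdd ((1 : ℤ), (0 : ℤ)))) 0
  have h2 := congr_fun (hx (Multiplicative.ofAdd ((0 : ℤ), (1 : ℤ)))) 1
  simp [hρ] at h1 h2
  linarith

/-- `φ(a, b) = (a, 0, 0)` is UNDETECTED by every single element: `φ(a, b) ∈ (ρ(a, b) - 1)ℚ³`
for all `(a, b)`.  Since `ρ(a, b) - 1 = [[0, 2b, 2b² + a], [0, 0, 2b], [0, 0, 0]]`, one may take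
`v = (0, a / 2b, 0)` when `b ≠ 0` and `v = (0, 0, 1)` when `b = 0` (`ρ(a, 0) - 1 = a E₁₃`).
[cite: Schnell2010, §6 Example] -/
theorem localTubeSpan_schnellCocycle_mem_subOneRange (g : Multiplicative (ℤ × ℤ)) :
    (![((Multiplicative.toAdd g).1 : ℚ), 0, 0] : Fin 3 → ℚ) ∈
      subOneRange (Rep.of ρ) g := by
  by_cases hb : (Multiplicative.toAdd g).2 = 0
  · refine ⟨![0, 0, 1], ?_⟩
    rw [LinearMap.sub_apply, LinearMap.id_apply, Rep.of_ρ, hρ]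
    funext i
    fin_cases i <;> simp [hb]
  · have hb' : ((Multiplicative.toAdd g).2 : ℚ) ≠ 0 := by exact_mod_cast hb
    refine ⟨![0, ((Multiplicative.toAdd g).1 : ℚ) / (2 * (Multiplicative.toAdd g).2), 0], ?_⟩
    rw [LinearMap.sub_apply, LinearMap.id_apply, Rep.of_ρ, hρ]
    funext i
    fin_cases i <;> simp
    field_simp

end Cocycle

/-! ### The stub: the third map is not injective in general -/

/-- **Schnell's example (tightness of the local tube-span mechanism).** Without rank-one
(transvection) hypotheses Schnell's third map `H¹(G, A) → ∏_{g ∈ G} A/(g - 1)A` need not be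
injective: for `G = ℤ²` acting on `ℚ³` through the commuting unipotent matrices
`A₁ = [[1,0,1],[0,1,0],[0,0,1]]`, `A₂ = [[1,2,2],[0,1,2],[0,0,1]]`, the class of the cocycle
`φ(a, b) = (a, 0, 0)` is non-zero but undetected by every element.  Hence the third map of SOME
representation is not injective. [cite: Schnell2010, §6 Example] -/
theorem localTubeSpan_exists_not_injective_evalCoinv :
    ∃ (G : Type) (_ : Group G) (A : Rep ℚ G), ¬ Function.Injective (evalCoinv A) := by
  obtain ⟨ρ, -, -, hρ⟩ := localTubeSpan_exists_schnellRep
  exact ⟨Multiplicative (ℤ × ℤ), inferInstance, Rep.of ρ,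
    localTubeSpan_not_injective_evalCoinv_of_undetected (Rep.of ρ) _
      (localTubeSpan_schnellCocycle_mem_cocycles₁ ρ hρ)
      (localTubeSpan_schnellCocycle_notMem_coboundaries₁ ρ hρ)
      (localTubeSpan_schnellCocycle_mem_subOneRange ρ hρ)⟩

end Summit.HodgeConjecture.HodgeConjecture.Theorems

end
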